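import Mathlib
import Literature.Probability.Percolation.CardyFormula
import Literature.Probability.LatticeModels.MedialInterface
import Literature.MathematicalPhysics.QuantumLattice.RandomField
import HarnessLib

/-!
# Smoothed white-noise percolation on `ℤ²` and in the continuum (definitions)

Topic `Literature/Probability/Percolation` (definition item `defn-SmoothedWhiteNoisePercolation`,
route `CriticalPhenomena/CardyFormulaZ2/CardyWhiteToColoured`, card `white-to-coloured-noise`).

Named versions — with `rfl` bridges to the inline terms of the route items `DriftBound`,
`NoiseDiscretisation`, `NoiseFlowComparison`, `EuclideanCovariance`, `ModelExists` — of the two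
"smoothed white noise" percolation models of Muirhead–Vanneuville (Ann. Inst. H. Poincaré Probab.
Stat. 56 (2020), §2.1: the discretised white noise `W^ε` on `εℤ²` and the smoothed field
`f^ε = q ⋆ W^ε`; Beliaev–Muirhead–Rivera 2020; Beffara–Gayet, Publ. IHÉS 126 (2017), §1: percolation
of the excursion / sign sets `{f > 0}` of smooth planar Gaussian fields such as the Bargmann–Fock
field, whose covariance is the Gaussian kernel):

## 1. Lattice model (inline objects of `DriftBound` / `NoiseDiscretisation`)

* `latticeWhiteNoise` — i.i.d. standard Gaussians `ξ_e`, `e ∈ E(ℤ²)`: the product measure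
  `Measure.infinitePi (fun _ : E(ℤ²) ↦ gaussianReal 0 1)` on `E(ℤ²) → ℝ`
  (`E(ℤ²) = (zdGraph 2).edgeSet`, the tree's square lattice).
* `gaussWeight ℓ z = exp(−|z|²/(2ℓ²))` — the Gaussian kernel at scale `ℓ`.
* `smoothedNoise ℓ δ ξ x = ∑' e', exp(−|x − m_δ(e')|²/(2ℓ²)) ξ_{e'}` — the field at `x ∈ ℂ`, the
  noise sitting at the medial points `m_δ = medialPoint δ` (midpoints of the edges of `δℤ²`);
  `tsum`, junk `0` if not summable (a.s. absolutely summable: Gaussian tails).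
* `signConfig ℓ δ ξ = {e ∈ E(ℤ²) | smoothedNoise ℓ δ ξ (m_δ e) > 0} : BondConfig (Site 2)` — the bond
  configuration of positive signs; `signConfigLaw ℓ δ` its law (push-forward);
  `smoothedCrossingProb ℓ δ Ω A B` — the probability that the tree's discrete crossing event
  `discreteCrossing Ω δ A B` (G02, `Crossings.lean`) occurs for `signConfig`.
  `smoothedCrossingProb_conformalRectangle_eq` is the `rfl` bridge to the inline term
  `P^latt_{ℓ,δ}(R)` of `DriftBound` and `NoiseDiscretisation`.

## 2. Continuum model (inline objects of `NoiseFlowComparison` / `NoiseDiscretisation` /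
`EuclideanCovariance` / `ModelExists`)

* `IsWhiteNoise μ` — `μ` is a white noise on `ℂ`: a centred Gaussian field on `𝒮'(ℂ)` (the tree's
  `QuantumLattice.IsGaussianField`, `FieldConfig ℂ`) with generating functional
  `S(f) = exp(−½‖f‖²_{L²})` (Glimm–Jaffe §6.2; existence is the tree's
  `QuantumFieldTheory.exists_gaussianField_of_bilinForm`, uniqueness
  `gaussianField_of_genFunctional_unique` — the route's `ModelExists`, not restated).
* `IsGaussianBumpFamily k` — `k ℓ x ∈ 𝒮(ℂ, ℝ)` is the Gaussian bump `y ↦ exp(−|y − x|²/(2ℓ²))` for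
  `ℓ > 0` (the route quantifies over such families; constructing one — smoothness and Schwartz decay
  of the Gaussian — is the provable-now half of `ModelExists` and is not done here).
* `continuumCrossingEvent k ℓ R` — the event that the smoothed field `x ↦ ω(k ℓ x)` is positive along
  some path in `closure R.carrier` from `R.arc 0` to `R.arc 2` of a conformal rectangle `R`;
  `continuumCrossingProb μ k ℓ R = μ.real (continuumCrossingEvent k ℓ R)`; `rfl` bridges
  `continuumCrossingProb_eq`.

## API (proved)

`rfl` bridges; `signConfig ⊆ E(ℤ²)`; `latticeWhiteNoise` is a probability measure, so
`smoothedCrossingProb ∈ [0, 1]`; `smoothedCrossingProb` through the law under measurability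
(`smoothedCrossingProb_eq_signConfigLaw_real`); symmetry `k ℓ x y = k ℓ y x` and positivity of
Gaussian bumps; `continuumCrossingProb ∈ [0, 1]` for probability `μ`.

## Not here (the item's "wanted lemmas", each a theorem of its own)

Exact self-duality of the lattice model at every `ℓ` (the dual edge of `ℤ²` has the same midpoint and
`ξ ↦ −ξ` preserves the law; square crossing probability `= ½` up to ties), `D₄`-invariance, positive
association (Pitt 1982: non-negative covariances), the similarity covariance
`P_{|a|ℓ}(aR + w) = P_ℓ(R)` of the continuum family (route item `EuclideanCovariance`), and the
`ℓ → 0` limit at fixed `δ` recovering `bondPercolation (zdGraph 2) half` crossing probabilities.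
Measurability of `signConfig` (needed to identify `smoothedCrossingProb` with the law of
`signConfig`) is likewise left to users (`smoothedCrossingProb_eq_signConfigLaw_real` takes it as a
hypothesis).

## References

* S. Muirhead, H. Vanneuville, *The sharp phase transition for level set percolation of smooth
  planar Gaussian fields*, Ann. Inst. H. Poincaré Probab. Stat. 56 (2020), §2.1 (discretised white
  noise `W^ε`, `f^ε = q ⋆ W^ε`), Prop. 3.11. [MuirheadVanneuville2020]
* D. Beliaev, S. Muirhead, A. Rivera, *A covariance formula for topological events of smooth
  Gaussian fields*, Ann. Probab. 48 (2020). [BeliaevMuirheadRivera2020]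
* V. Beffara, D. Gayet, *Percolation of random nodal lines*, Publ. Math. IHÉS 126 (2017), §1.
  [BeffaraGayet2017]
* J. Glimm, A. Jaffe, *Quantum Physics* (1987), §6.2 (Gaussian measures on `𝒮'`, white noise).
  [GlimmJaffeQP1987]
-/

open scoped BigOperators
open MeasureTheory ProbabilityTheory Set

noncomputable section

namespace Literature.Probability.Percolation

open Literature.Probability.LatticeModels
open Literature.MathematicalPhysics.QuantumLattice (FieldConfig IsGaussianField genFunctional)

/-! ## 1. The lattice model: white noise on the edges of `ℤ²`, smoothed at scale `ℓ` -/

section Lattice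

/-- **Lattice white noise on `ℤ²`**: i.i.d. standard Gaussian variables `ξ_e ~ N(0,1)` indexed by
the edges `e ∈ E(ℤ²)` of the square lattice (`zdGraph 2`), as the product probability measure
`⨂_e N(0,1)` on `E(ℤ²) → ℝ` (Mathlib `Measure.infinitePi`, `gaussianReal 0 1`). This is
Muirhead–Vanneuville's discretised white noise `W^ε` (2020, §2.1) placed on the medial lattice.
[cite: MuirheadVanneuville2020, §2.1] -/
def latticeWhiteNoise : Measure ((zdGraph 2).edgeSet → ℝ) :=
  Measure.infinitePi (fun _ : (zdGraph 2).edgeSet => gaussianReal 0 1)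

/-- `latticeWhiteNoise` is a probability measure (product of probability measures). [folklore] -/
instance isProbabilityMeasure_latticeWhiteNoise : IsProbabilityMeasure latticeWhiteNoise := by
  unfold latticeWhiteNoise; infer_instance

/-- The **Gaussian kernel** at scale `ℓ`: `q_ℓ(z) = exp(−|z|²/(2ℓ²))` (the default radial
smoothing kernel; Muirhead–Vanneuville 2020, §2.1 `q`; the Bargmann–Fock covariance,
Beffara–Gayet 2017, §1). [cite: MuirheadVanneuville2020, §2.1] -/
def gaussWeight (ℓ : ℝ) (z : ℂ) : ℝ :=
  Real.exp (-(‖z‖ ^ 2) / (2 * ℓ ^ 2))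

/-- The Gaussian kernel is positive. [folklore] -/
theorem gaussWeight_pos (ℓ : ℝ) (z : ℂ) : 0 < gaussWeight ℓ z :=
  Real.exp_pos _

/-- The Gaussian kernel is radial: `q_ℓ(−z) = q_ℓ(z)`. [folklore] -/
@[simp] theorem gaussWeight_neg (ℓ : ℝ) (z : ℂ) : gaussWeight ℓ (-z) = gaussWeight ℓ z := by
  simp [gaussWeight, norm_neg]

/-- `q_ℓ(x − y) = q_ℓ(y − x)`. [folklore] -/
theorem gaussWeight_sub_comm (ℓ : ℝ) (x y : ℂ) : gaussWeight ℓ (x - y) = gaussWeight ℓ (y - x) := by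
  rw [← gaussWeight_neg, neg_sub]

/-- **The smoothed lattice white noise** at scale `ℓ` and mesh `δ`, evaluated at `x ∈ ℂ`:
`F_{ℓ,δ}(ξ)(x) = ∑_{e' ∈ E(ℤ²)} exp(−|x − m_δ(e')|²/(2ℓ²)) ξ_{e'}`, the noise `ξ_{e'}` sitting at
the medial point `m_δ(e') = medialPoint δ e'` (midpoint of the rescaled edge). Unconditional sum
(`tsum`; junk value `0` when not summable — almost surely it is absolutely summable). This is
`f^ε = q ⋆ W^ε` of Muirhead–Vanneuville 2020, §2.1, read at an arbitrary point.
[cite: MuirheadVanneuville2020, §2.1] -/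
def smoothedNoise (ℓ δ : ℝ) (ξ : (zdGraph 2).edgeSet → ℝ) (x : ℂ) : ℝ :=
  ∑' e' : (zdGraph 2).edgeSet, Real.exp (-(‖x - medialPoint δ e'.1‖ ^ 2) / (2 * ℓ ^ 2)) * ξ e'

/-- `smoothedNoise` written with the kernel `gaussWeight`. [folklore] -/
theorem smoothedNoise_eq_tsum_gaussWeight (ℓ δ : ℝ) (ξ : (zdGraph 2).edgeSet → ℝ) (x : ℂ) :
    smoothedNoise ℓ δ ξ x = ∑' e' : (zdGraph 2).edgeSet, gaussWeight ℓ (x - medialPoint δ e'.1) * ξ e' :=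
  rfl

/-- **The sign bond configuration** of the smoothed noise: the set of lattice edges `e ∈ E(ℤ²)` at
whose medial point the smoothed field is positive, `{e | F_{ℓ,δ}(ξ)(m_δ e) > 0}`, as a bond
configuration on `ℤ²` (`BondConfig (Site 2) = Set (Sym2 (Site 2))`; non-edges are closed). The
discrete analogue of the excursion set `{f > 0}` (Beffara–Gayet 2017, §1; Muirhead–Vanneuville
2020, §2.1). [cite: MuirheadVanneuville2020, §2.1] -/
def signConfig (ℓ δ : ℝ) (ξ : (zdGraph 2).edgeSet → ℝ) : BondConfig (Site 2) :=
  {e : Sym2 (Site 2) | e ∈ (zdGraph 2).edgeSet ∧ 0 < smoothedNoise ℓ δ ξ (medialPoint δ e)}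

/-- Membership in the sign configuration. [folklore] -/
theorem mem_signConfig_iff (ℓ δ : ℝ) (ξ : (zdGraph 2).edgeSet → ℝ) (e : Sym2 (Site 2)) :
    e ∈ signConfig ℓ δ ξ ↔ e ∈ (zdGraph 2).edgeSet ∧ 0 < smoothedNoise ℓ δ ξ (medialPoint δ e) :=
  Iff.rfl

/-- Only lattice edges are open in the sign configuration. [folklore] -/
theorem signConfig_subset_edgeSet (ℓ δ : ℝ) (ξ : (zdGraph 2).edgeSet → ℝ) :
    signConfig ℓ δ ξ ⊆ (zdGraph 2).edgeSet :=
  fun _ he => he.1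

/-- **The law of the sign configuration**: push-forward of the lattice white noise under
`signConfig ℓ δ`, a measure on bond configurations of `ℤ²` (meaningful — a probability measure —
once `signConfig ℓ δ` is known to be measurable). [cite: MuirheadVanneuville2020, §2.1] -/
def signConfigLaw (ℓ δ : ℝ) : Measure (BondConfig (Site 2)) :=
  latticeWhiteNoise.map (signConfig ℓ δ)

/-- **Crossing probability of the smoothed lattice model**: the probability, under i.i.d. `N(0,1)`
edge variables, that the tree's discrete crossing event `discreteCrossing Ω δ A B` (an open crossing
of the discrete domain `Ω_δ` between the discrete arcs of `A` and `B`, `Crossings.lean`) occurs for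
the sign configuration `signConfig ℓ δ ξ`. For a conformal rectangle this is `P^latt_{ℓ,δ}(R)` of
route `CardyWhiteToColoured` (`smoothedCrossingProb_conformalRectangle_eq`).
[cite: MuirheadVanneuville2020, §2.1] -/
def smoothedCrossingProb (ℓ δ : ℝ) (Ω : Set ℂ) (A B : Set ℂ) : ℝ :=
  latticeWhiteNoise.real (signConfig ℓ δ ⁻¹' discreteCrossing Ω δ A B)

/-- **`rfl` bridge to the route's inline term**: for a conformal rectangle `R`,
`smoothedCrossingProb ℓ δ R.carrier (R.arc 0) (R.arc 2)` is literally the expression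
`P^latt_{ℓ,δ}(R)` appearing in the items `DriftBound` and `NoiseDiscretisation` of route
`CriticalPhenomena/CardyFormulaZ2/CardyWhiteToColoured`. [folklore] -/
theorem smoothedCrossingProb_conformalRectangle_eq (ℓ δ : ℝ)
    (R : RandomPlanarGeometry.ConformalRectangle) :
    smoothedCrossingProb ℓ δ R.carrier (R.arc 0) (R.arc 2) =
      (MeasureTheory.Measure.infinitePi
          (fun _ : (zdGraph 2).edgeSet => ProbabilityTheory.gaussianReal 0 1)).real
        ((fun ξ => {e : Sym2 (Site 2) | e ∈ (zdGraph 2).edgeSet ∧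
            0 < ∑' e' : (zdGraph 2).edgeSet,
              Real.exp (-(‖medialPoint δ e - medialPoint δ e'.1‖ ^ 2) / (2 * ℓ ^ 2)) * ξ e'}) ⁻¹'
          discreteCrossing R.carrier δ (R.arc 0) (R.arc 2)) :=
  rfl

/-- Crossing probabilities of the smoothed lattice model lie in `[0, 1]`. [folklore] -/
theorem smoothedCrossingProb_mem_Icc (ℓ δ : ℝ) (Ω A B : Set ℂ) :
    smoothedCrossingProb ℓ δ Ω A B ∈ Icc (0 : ℝ) 1 :=
  ⟨measureReal_nonneg, measureReal_le_one⟩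

/-- Under measurability of the sign map and of the crossing event, the crossing probability is the
`signConfigLaw`-measure of the crossing event. [folklore] -/
theorem smoothedCrossingProb_eq_signConfigLaw_real {ℓ δ : ℝ} (hmeas : Measurable (signConfig ℓ δ))
    {Ω A B : Set ℂ} (hA : MeasurableSet (discreteCrossing Ω δ A B)) :
    smoothedCrossingProb ℓ δ Ω A B = (signConfigLaw ℓ δ).real (discreteCrossing Ω δ A B) := by
  rw [smoothedCrossingProb, signConfigLaw, measureReal_def, measureReal_def,
    Measure.map_apply hmeas hA]

end Lattice

/-! ## 2. The continuum model: white noise on `ℂ` smoothed by Gaussian bumps -/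

section Continuum

/-- **White noise on `ℂ`**: a centred Gaussian random field `μ` on the real tempered distributions
`𝒮'(ℂ)` (`FieldConfig ℂ`, `IsGaussianField`) with generating functional
`S(f) = 𝔼 exp(i ω(f)) = exp(−½ ∫ f²)`, i.e. covariance `𝔼 ω(f) ω(g) = ⟨f, g⟩_{L²(ℂ)}`
(Glimm–Jaffe §6.2; existence: `QuantumFieldTheory.exists_gaussianField_of_bilinForm`). This is the
hypothesis form `IsGaussianField μ ∧ ∀ f, genFunctional μ f = exp(−½‖f‖²)` of the route items
`NoiseFlowComparison`, `NoiseDiscretisation`, `EuclideanCovariance`, `ModelExists` (`Iff.rfl`).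
[cite: GlimmJaffeQP1987, §6.2] -/
def IsWhiteNoise (μ : Measure (FieldConfig ℂ)) : Prop :=
  IsGaussianField μ ∧
    ∀ f : SchwartzMap ℂ ℝ, genFunctional μ f = Complex.exp (-(1 / 2 : ℂ) * ((∫ z, f z ^ 2 : ℝ) : ℂ))

/-- A white noise is a Gaussian field. [cite: GlimmJaffeQP1987, §6.2] -/
theorem IsWhiteNoise.isGaussianField {μ : Measure (FieldConfig ℂ)} (h : IsWhiteNoise μ) :
    IsGaussianField μ :=
  h.1

/-- The generating functional of a white noise. [cite: GlimmJaffeQP1987, §6.2] -/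
theorem IsWhiteNoise.genFunctional_eq {μ : Measure (FieldConfig ℂ)} (h : IsWhiteNoise μ)
    (f : SchwartzMap ℂ ℝ) :
    genFunctional μ f = Complex.exp (-(1 / 2 : ℂ) * ((∫ z, f z ^ 2 : ℝ) : ℂ)) :=
  h.2 f

/-- **Gaussian bump family**: `k ℓ x ∈ 𝒮(ℂ, ℝ)` is the Gaussian bump
`y ↦ exp(−|y − x|²/(2ℓ²))` centred at `x` at every scale `ℓ > 0` (the smoothing kernel of the
continuum model; the Bargmann–Fock kernel, Beffara–Gayet 2017, §1). The route quantifies over such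
families (hypothesis form, `Iff.rfl` with the inline clause); `ω (k ℓ x)` is then the smoothed white
noise `(q_ℓ ⋆ W)(x)`. [cite: BeffaraGayet2017, §1] -/
def IsGaussianBumpFamily (k : ℝ → ℂ → SchwartzMap ℂ ℝ) : Prop :=
  ∀ ℓ : ℝ, 0 < ℓ → ∀ x y : ℂ, k ℓ x y = Real.exp (-(‖y - x‖ ^ 2) / (2 * ℓ ^ 2))

/-- A Gaussian bump family consists of the kernels `gaussWeight`: `k ℓ x y = q_ℓ(y − x)`. [folklore] -/
theorem IsGaussianBumpFamily.apply_eq_gaussWeight {k : ℝ → ℂ → SchwartzMap ℂ ℝ}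
    (hk : IsGaussianBumpFamily k) {ℓ : ℝ} (hℓ : 0 < ℓ) (x y : ℂ) :
    k ℓ x y = gaussWeight ℓ (y - x) :=
  hk ℓ hℓ x y

/-- Gaussian bumps are positive. [folklore] -/
theorem IsGaussianBumpFamily.apply_pos {k : ℝ → ℂ → SchwartzMap ℂ ℝ} (hk : IsGaussianBumpFamily k)
    {ℓ : ℝ} (hℓ : 0 < ℓ) (x y : ℂ) : 0 < k ℓ x y := by
  rw [hk ℓ hℓ x y]
  exact Real.exp_pos _

/-- Gaussian bumps are symmetric in centre and argument: `k ℓ x y = k ℓ y x`. [folklore] -/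
theorem IsGaussianBumpFamily.apply_comm {k : ℝ → ℂ → SchwartzMap ℂ ℝ} (hk : IsGaussianBumpFamily k)
    {ℓ : ℝ} (hℓ : 0 < ℓ) (x y : ℂ) : k ℓ x y = k ℓ y x := by
  rw [hk ℓ hℓ x y, hk ℓ hℓ y x, norm_sub_rev]

/-- Gaussian bumps take the value `1` at their centre. [folklore] -/
theorem IsGaussianBumpFamily.apply_self {k : ℝ → ℂ → SchwartzMap ℂ ℝ} (hk : IsGaussianBumpFamily k)
    {ℓ : ℝ} (hℓ : 0 < ℓ) (x : ℂ) : k ℓ x x = 1 := by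
  rw [hk ℓ hℓ x x]
  simp

/-- **The continuum crossing event** of the conformal rectangle `R` for the smoothed white noise at
scale `ℓ`: there is a path `γ` in `closure R.carrier` from a point of the arc `R.arc 0` to a point
of the opposite arc `R.arc 2` along which the smoothed field `x ↦ ω(k ℓ x)` is positive — the
crossing of `R̄` by the excursion set `{q_ℓ ⋆ W > 0}` (Beffara–Gayet 2017, §1; the inline event of
`NoiseFlowComparison`, `NoiseDiscretisation`, `EuclideanCovariance`). [cite: BeffaraGayet2017, §1] -/
def continuumCrossingEvent (k : ℝ → ℂ → SchwartzMap ℂ ℝ) (ℓ : ℝ)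
    (R : RandomPlanarGeometry.ConformalRectangle) : Set (FieldConfig ℂ) :=
  {ω | ∃ x ∈ R.arc 0, ∃ y ∈ R.arc 2, ∃ γ : Path x y, ∀ t, γ t ∈ closure R.carrier ∧ 0 < ω (k ℓ (γ t))}

/-- Membership in the continuum crossing event. [folklore] -/
theorem mem_continuumCrossingEvent_iff (k : ℝ → ℂ → SchwartzMap ℂ ℝ) (ℓ : ℝ)
    (R : RandomPlanarGeometry.ConformalRectangle) (ω : FieldConfig ℂ) :
    ω ∈ continuumCrossingEvent k ℓ R ↔
      ∃ x ∈ R.arc 0, ∃ y ∈ R.arc 2, ∃ γ : Path x y, ∀ t, γ t ∈ closure R.carrier ∧ 0 < ω (k ℓ (γ t)) :=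
  Iff.rfl

/-- **The continuum crossing probability** `P^cont_ℓ(R) = μ(continuumCrossingEvent k ℓ R)` of the
conformal rectangle `R` for the white noise `μ` smoothed by the bump family `k` at scale `ℓ`.
[cite: BeffaraGayet2017, §1] -/
def continuumCrossingProb (μ : Measure (FieldConfig ℂ)) (k : ℝ → ℂ → SchwartzMap ℂ ℝ) (ℓ : ℝ)
    (R : RandomPlanarGeometry.ConformalRectangle) : ℝ :=
  μ.real (continuumCrossingEvent k ℓ R)

/-- **`rfl` bridge to the route's inline term**: `continuumCrossingProb μ k ℓ R` is literally the
expression `μ.real {ω | ∃ x ∈ R.arc 0, ∃ y ∈ R.arc 2, ∃ γ : Path x y, ∀ t, γ t ∈ closure R.carrier ∧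
0 < ω (k ℓ (γ t))}` of the items `NoiseFlowComparison`, `NoiseDiscretisation` and
`EuclideanCovariance`. [folklore] -/
theorem continuumCrossingProb_eq (μ : Measure (FieldConfig ℂ)) (k : ℝ → ℂ → SchwartzMap ℂ ℝ) (ℓ : ℝ)
    (R : RandomPlanarGeometry.ConformalRectangle) :
    continuumCrossingProb μ k ℓ R =
      μ.real {ω | ∃ x ∈ R.arc 0, ∃ y ∈ R.arc 2, ∃ γ : Path x y,
        ∀ t, γ t ∈ closure R.carrier ∧ 0 < ω (k ℓ (γ t))} :=
  rfl

/-- Continuum crossing probabilities of a probability measure lie in `[0, 1]`. [folklore] -/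
theorem continuumCrossingProb_mem_Icc (μ : Measure (FieldConfig ℂ)) [IsProbabilityMeasure μ]
    (k : ℝ → ℂ → SchwartzMap ℂ ℝ) (ℓ : ℝ) (R : RandomPlanarGeometry.ConformalRectangle) :
    continuumCrossingProb μ k ℓ R ∈ Icc (0 : ℝ) 1 :=
  ⟨measureReal_nonneg, measureReal_le_one⟩

/-- **`rfl` bridge for the lattice–continuum comparison**: the quantity compared in the route item
`NoiseDiscretisation`, `|P^latt_{ℓ,δ}(R) − P^cont_ℓ(R)|`, in named form. [folklore] -/
theorem abs_smoothedCrossingProb_sub_continuumCrossingProb_eq (μ : Measure (FieldConfig ℂ))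
    (k : ℝ → ℂ → SchwartzMap ℂ ℝ) (ℓ δ : ℝ) (R : RandomPlanarGeometry.ConformalRectangle) :
    |smoothedCrossingProb ℓ δ R.carrier (R.arc 0) (R.arc 2) - continuumCrossingProb μ k ℓ R| =
      |(MeasureTheory.Measure.infinitePi
          (fun _ : (zdGraph 2).edgeSet => ProbabilityTheory.gaussianReal 0 1)).real
        ((fun ξ => {e : Sym2 (Site 2) | e ∈ (zdGraph 2).edgeSet ∧
            0 < ∑' e' : (zdGraph 2).edgeSet,
              Real.exp (-(‖medialPoint δ e - medialPoint δ e'.1‖ ^ 2) / (2 * ℓ ^ 2)) * ξ e'}) ⁻¹'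
          discreteCrossing R.carrier δ (R.arc 0) (R.arc 2)) -
        μ.real {ω | ∃ x ∈ R.arc 0, ∃ y ∈ R.arc 2, ∃ γ : Path x y,
          ∀ t, γ t ∈ closure R.carrier ∧ 0 < ω (k ℓ (γ t))}| :=
  rfl

end Continuum

end Literature.Probability.Percolation

end
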